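import Summits.RiemannHypothesis.RiemannHypothesis.Theorems.PfPersistenceEdgeLawCuspInterior
import Literature.Analysis.PDE.FarChannelsStepData

/-!
# Edge law — the mass of the interior defect under a cusp modulus with remainder (RH-free)

Part of the pub-rhpf THEORY-2 programme (mechanism / rigidity of the Weil window bottom; no RH
claims). For a window state with a cusp modulus with remainder (`HasCuspModulusWith a u C Ξ`,
`IsCuspRemainder Ξ ω`, `C ≥ 0`) the interior dilation defect `t_η = 1_{[-b,b]} g_η`
(`b = a/(1+η)`, `h = h(η) = a − b`) has small mass:

* `integral_norm_sq_weilInteriorDefect_le_with`: for every split scale `0 < δ ≤ h`,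
  `‖t_η‖² ≤ 6a η² (C G(a) + ω(2a))² + 6 C² (h ψ(δ)) (h G(a)) + 24 C² G(h)² δ + 6 h ω(2h) ω(2a)`
  (`G = cuspPrim a`, `ψ = cuspWeight a`): the germ is
  `≤ η (C G(a) + ω(2a)) + C (Γ(|x|+h) − Γ(|x|)) + (Ξ(x+h) − Ξ(x−h))`; the radial shift
  `Γ(·+h) − Γ` is `≤ h ψ(δ)` at distance `≥ δ` from the compressed edge with integral `≤ h G(a)`
  and `≤ 2 G(h)` on the last stretch of length `δ`; the remainder shift `Ξ(·+h) − Ξ(·−h)` is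
  `≤ ω(2h)` with integral `≤ 2h (Ξ(a) − Ξ(−a)) ≤ 2h ω(2a)` over the compressed window.

Sources: E. Bombieri, *Remarks on Weil's quadratic functional in the theory of prime numbers I*,
Rend. Mat. Acc. Lincei (9) 11 (2000) §4 (proof of Thm 5: the dilation); the remainder term is this
programme's (interior cusps at `±(a − log q)`, THEORY-2g).
-/

set_option linter.dupNamespace false

noncomputable section

open MeasureTheory Set Filter
open scoped Topology ENNReal

namespace Summit.RiemannHypothesis.RiemannHypothesis.Theorems.PfPersistence

open Literature.NumberTheory.LFunctions

variable {a : ℝ} {u : ℝ → ℂ}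

/-! ## The remainder shift over the compressed window -/

/-- **The remainder shift has small integral**: `∫_{-b}^{b} (Ξ(x+h) − Ξ(x−h)) dx ≤ 2h ω(2a)` for
`b + h = a`, `0 ≤ h ≤ b` (`ω(2a) ≥ Ξ(a) − Ξ(−a)`). [folklore] -/
theorem integral_remainder_shift_le {Ξ ω : ℝ → ℝ} (hR : IsCuspRemainder Ξ ω) {b h : ℝ}
    (hh : 0 ≤ h) (hhb : h ≤ b) (hab : b + h = a) :
    ∫ x in (-b)..b, (Ξ (x + h) - Ξ (x - h)) ≤ 2 * h * ω (2 * a) := by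
  have hb0 : 0 ≤ b := hh.trans hhb
  set f : ℝ → ℝ := fun y ↦ Ξ (y + 2 * h) - Ξ y with hf
  have e1 : (fun x ↦ Ξ (x + h) - Ξ (x - h)) = fun x ↦ f (x - h) := by
    funext x
    simp only [hf]
    rw [show x - h + 2 * h = x + h by ring]
  rw [e1, intervalIntegral.integral_comp_sub_right f h]
  have hmono : MonotoneOn Ξ (Icc (-b - h) (b - h + 2 * h)) := fun x _ y _ hxy ↦ hR.mono hxy
  have h1 := integral_shift_sub_le (Θ := Ξ) (α := -b - h) (β := b - h) (s := 2 * h)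
    (by linarith) (by linarith) hmono
  have h2 : Ξ (b - h + 2 * h) - Ξ (-b - h) ≤ ω (2 * a) :=
    hR.sub_le_of_le (by linarith) (by linarith)
  calc ∫ x in (-b - h)..(b - h), f x = ∫ x in (-b - h)..(b - h), (Ξ (x + 2 * h) - Ξ x) := rfl
    _ ≤ 2 * h * (Ξ (b - h + 2 * h) - Ξ (-b - h)) := h1
    _ ≤ 2 * h * ω (2 * a) := mul_le_mul_of_nonneg_left h2 (by linarith)

/-! ## The mass of the interior defect -/

/-- **Mass of the interior defect under a cusp modulus with remainder**: for every
`0 < δ ≤ h = h(η)` (`0 < η ≤ 1`, `C ≥ 0`),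
`‖t_η‖² ≤ 6a η² (C G(a) + ω(2a))² + 6 C² (h ψ(δ)) (h G(a)) + 24 C² G(h)² δ + 6 h ω(2h) ω(2a)`.
[cite: Bombieri2000Weil, §4 proof of Thm 5 (the dilation)] -/
theorem integral_norm_sq_weilInteriorDefect_le_with {C : ℝ} {Ξ ω : ℝ → ℝ}
    (hC : HasCuspModulusWith a u C Ξ) (hR : IsCuspRemainder Ξ ω) (hC0 : 0 ≤ C) (ha : 0 < a)
    {η : ℝ} (hη : 0 < η) (hη1 : η ≤ 1) {δ : ℝ} (hδ : 0 < δ) (hδh : δ ≤ layerDepth a η) :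
    ∫ x, ‖weilInteriorDefect a u η x‖ ^ 2 ≤
      6 * a * η ^ 2 * (C * cuspPrim a a + ω (2 * a)) ^ 2 +
        6 * C ^ 2 * (layerDepth a η * cuspWeight a δ) * (layerDepth a η * cuspPrim a a) +
        24 * C ^ 2 * cuspPrim a (layerDepth a η) ^ 2 * δ +
        6 * layerDepth a η * ω (2 * layerDepth a η) * ω (2 * a) := by
  have hη0 : 0 < 1 + η := by linarith
  set b := a / (1 + η) with hb_def
  set h := layerDepth a η with hh_def
  have hb : b ≤ a := div_le_self ha.le (by linarith)
  have hb0 : 0 < b := div_pos ha hη0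
  have hhb : h ≤ b := layerDepth_le_window ha.le hη.le hη1
  have hh0 : 0 < h := layerDepth_pos ha hη
  have hab : b + h = a := by
    have := sub_layerDepth (a := a) (η := η) (by linarith); rw [← hb_def, ← hh_def] at this; linarith
  set c := b - δ with hc_def
  have hc0 : 0 ≤ c := by rw [hc_def]; linarith
  set G := cuspPrim a a with hG_def
  set B := C * G + ω (2 * a) with hB_def
  set w := ω (2 * h) with hw_def
  set S := h * cuspWeight a δ with hS_def
  set Δ : ℝ → ℝ := fun r ↦ cuspCoord a (r + h) - cuspCoord a r with hΔ_def
  set E : ℝ → ℝ := fun x ↦ Ξ (x + h) - Ξ (x - h) with hE_def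
  have hG0 : 0 ≤ G := cuspPrim_nonneg _ _
  have hS0 : 0 ≤ S := mul_nonneg hh0.le (cuspWeight_pos hδ (by linarith)).le
  have hw0 : 0 ≤ w := hR.modulus_nonneg (by linarith)
  have hE0 : ∀ x, 0 ≤ E x := fun x ↦ hR.sub_nonneg (by linarith)
  have hEw : ∀ x, E x ≤ w := fun x ↦ hR.sub_le_of_le (by linarith) (by linarith)
  -- the radial shift `Δ` on `[0, b]`
  have hΔ0 : ∀ r, 0 ≤ r → r ≤ b → 0 ≤ Δ r := fun r hr hrb ↦
    sub_nonneg.2 (cuspCoord_mono (by linarith) (by linarith) (by linarith))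
  have hΔfar : ∀ r, 0 ≤ r → r ≤ c → Δ r ≤ S := by
    intro r hr hrc
    have h1 := cuspCoord_sub_le_mul (a := a) hr (by linarith : r ≤ r + h) (by rw [hc_def] at hrc; linarith)
    have h2 := cuspWeight_antitone (a := a) hδ (by rw [hc_def] at hrc; linarith : δ ≤ a - (r + h))
      (by linarith)
    calc Δ r ≤ (r + h - r) * cuspWeight a (a - (r + h)) := h1
      _ = h * cuspWeight a (a - (r + h)) := by ring
      _ ≤ S := mul_le_mul_of_nonneg_left h2 hh0.le
  have hΔnear : ∀ r, 0 ≤ r → r ≤ b → Δ r ≤ 2 * cuspPrim a h := by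
    intro r hr hrb
    have := cuspCoord_sub_le (a := a) (x := r) (y := r + h) (by linarith) (by linarith) (by linarith)
      (by linarith)
    simpa [hΔ_def] using this
  -- the radial majorant on `(0, ∞)` and the remainder majorant
  set A := 3 * η ^ 2 * B ^ 2 with hA_def
  set D := 12 * C ^ 2 * cuspPrim a h ^ 2 with hD_def
  set F₁ : ℝ → ℝ := (Ioc 0 b).indicator fun _ ↦ A with hF₁
  set F₂ : ℝ → ℝ := (Ioc 0 c).indicator fun r ↦ 3 * C ^ 2 * S * Δ r with hF₂
  set F₃ : ℝ → ℝ := (Ioc c b).indicator fun _ ↦ D with hF₃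
  set F : ℝ → ℝ := fun r ↦ F₁ r + F₂ r + F₃ r with hF_def
  set F₄ : ℝ → ℝ := (Icc (-b) b).indicator fun x ↦ 3 * w * E x with hF₄
  have hF1 : ∀ r, 0 ≤ F₁ r := fun r ↦ by
    simp only [hF₁]; exact indicator_nonneg (fun _ _ ↦ by positivity) r
  have hF2 : ∀ r, 0 ≤ F₂ r := fun r ↦ by
    simp only [hF₂]
    exact indicator_nonneg (fun r hr ↦ mul_nonneg (by positivity)
      (hΔ0 r hr.1.le (by linarith [hr.2]))) r
  have hF3 : ∀ r, 0 ≤ F₃ r := fun r ↦ by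
    simp only [hF₃]; exact indicator_nonneg (fun _ _ ↦ by positivity) r
  have hF0 : ∀ r, 0 ≤ F r := fun r ↦ by
    simp only [hF_def]; exact add_nonneg (add_nonneg (hF1 r) (hF2 r)) (hF3 r)
  have hF4 : ∀ x, 0 ≤ F₄ x := fun x ↦ by
    simp only [hF₄]; exact indicator_nonneg (fun x _ ↦ mul_nonneg (by positivity) (hE0 x)) x
  -- pointwise majorisation (off `x = 0`)
  have hpt : ∀ x, x ≠ 0 → ‖weilInteriorDefect a u η x‖ ^ 2 ≤ F |x| + F₄ x := by
    intro x hx0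
    rw [weilInteriorDefect_eq_indicator hη, ← hb_def]
    by_cases hx : x ∈ Icc (-b) b
    · have hxb : |x| ≤ b := abs_le.2 hx
      have hxp : 0 < |x| := abs_pos.2 hx0
      rw [indicator_of_mem hx]
      have hg := norm_dilationGerm_le_with hC hR hC0 ha hη.le hη1 (x := x) hxb
      rw [← hh_def, ← hG_def, ← hB_def] at hg
      have hd0 : 0 ≤ Δ |x| := hΔ0 _ hxp.le hxb
      have he0 : 0 ≤ E x := hE0 x
      have hI4 : F₄ x = 3 * w * E x := by simp only [hF₄, indicator_of_mem hx]
      have hsq : ‖dilationGerm a u η x‖ ^ 2 ≤ A + 3 * C ^ 2 * Δ |x| ^ 2 + F₄ x := by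
        have h1 : ‖dilationGerm a u η x‖ ^ 2 ≤ (η * B + C * Δ |x| + E x) ^ 2 :=
          pow_le_pow_left₀ (norm_nonneg _) hg 2
        have h2 : (η * B + C * Δ |x| + E x) ^ 2 ≤ A + 3 * C ^ 2 * Δ |x| ^ 2 + 3 * w * E x := by
          have h3 := Literature.Analysis.PDE.sq_add_three_le (η * B) (C * Δ |x|) (E x)
          have h4 : E x ^ 2 ≤ w * E x := by
            rw [sq]; exact mul_le_mul_of_nonneg_right (hEw x) he0
          have e : 3 * (η * B) ^ 2 + 3 * (C * Δ |x|) ^ 2 = A + 3 * C ^ 2 * Δ |x| ^ 2 := by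
            rw [hA_def]; ring
          linarith only [h3, h4, e]
        rw [hI4]
        exact h1.trans h2
      have hm1 : |x| ∈ Ioc 0 b := ⟨hxp, hxb⟩
      have hI1 : F₁ |x| = A := by simp only [hF₁, indicator_of_mem hm1]
      by_cases hxc : |x| ≤ c
      · have hm2 : |x| ∈ Ioc 0 c := ⟨hxp, hxc⟩
        have hI2 : F₂ |x| = 3 * C ^ 2 * S * Δ |x| := by simp only [hF₂, indicator_of_mem hm2]
        have hfar := hΔfar _ hxp.le hxc
        have : 3 * C ^ 2 * Δ |x| ^ 2 ≤ 3 * C ^ 2 * S * Δ |x| := by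
          have h' := mul_le_mul_of_nonneg_left hfar
            (mul_nonneg (by positivity : (0 : ℝ) ≤ 3 * C ^ 2) hd0)
          calc 3 * C ^ 2 * Δ |x| ^ 2 = 3 * C ^ 2 * Δ |x| * Δ |x| := by ring
            _ ≤ 3 * C ^ 2 * Δ |x| * S := h'
            _ = 3 * C ^ 2 * S * Δ |x| := by ring
        simp only [hF_def]
        linarith only [hsq, hI1, hI2, this, hF3 |x|]
      · rw [not_le] at hxc
        have hm3 : |x| ∈ Ioc c b := ⟨hxc, hxb⟩
        have hI3 : F₃ |x| = D := by simp only [hF₃, indicator_of_mem hm3]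
        have hnear := hΔnear _ hxp.le hxb
        have : 3 * C ^ 2 * Δ |x| ^ 2 ≤ D := by
          have h' := mul_le_mul_of_nonneg_left (pow_le_pow_left₀ hd0 hnear 2)
            (by positivity : (0 : ℝ) ≤ 3 * C ^ 2)
          calc 3 * C ^ 2 * Δ |x| ^ 2 ≤ 3 * C ^ 2 * (2 * cuspPrim a h) ^ 2 := h'
            _ = D := by rw [hD_def]; ring
        simp only [hF_def]
        linarith only [hsq, hI1, hI3, this, hF2 |x|]
    · rw [indicator_of_notMem hx, norm_zero, zero_pow two_ne_zero]
      exact add_nonneg (hF0 _) (hF4 _)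
  -- integrability of the majorants
  have hΔi : IntegrableOn (fun r ↦ 3 * C ^ 2 * S * Δ r) (Ioc 0 c) := by
    rcases eq_or_lt_of_le hc0 with hc | hc
    · rw [← hc, Ioc_self]; exact integrableOn_empty
    have hm1 : MonotoneOn (fun r ↦ cuspCoord a (r + h)) (uIcc 0 c) := by
      rw [uIcc_of_le hc.le]
      intro x hx y hy hxy
      exact cuspCoord_mono (by linarith [hx.1]) (by linarith) (by linarith [hy.2])
    have hm2 : MonotoneOn (cuspCoord a) (uIcc 0 c) := by
      rw [uIcc_of_le hc.le]
      intro x hx y hy hxy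
      exact cuspCoord_mono (by linarith [hx.1]) hxy (by linarith [hy.2])
    have hi := ((hm1.intervalIntegrable (μ := volume)).sub hm2.intervalIntegrable).const_mul
      (3 * C ^ 2 * S)
    rw [intervalIntegrable_iff_integrableOn_Ioc_of_le hc.le] at hi
    exact hi
  have hEi : IntervalIntegrable E volume (-b) b := by
    have hm1 : MonotoneOn (fun x ↦ Ξ (x + h)) (uIcc (-b) b) := fun x _ y _ hxy ↦
      hR.mono (by linarith)
    have hm2 : MonotoneOn (fun x ↦ Ξ (x - h)) (uIcc (-b) b) := fun x _ y _ hxy ↦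
      hR.mono (by linarith)
    exact (hm1.intervalIntegrable (μ := volume)).sub hm2.intervalIntegrable
  have hEi' : IntegrableOn (fun x ↦ 3 * w * E x) (Icc (-b) b) := by
    have hi := hEi.const_mul (3 * w)
    rw [intervalIntegrable_iff_integrableOn_Icc_of_le (by linarith)] at hi
    exact hi
  have hi1 : Integrable F₁ :=
    (integrableOn_const (by rw [Real.volume_Ioc]; exact ENNReal.ofReal_ne_top)
      (C := A)).integrable_indicator measurableSet_Ioc
  have hi2 : Integrable F₂ := hΔi.integrable_indicator measurableSet_Ioc
  have hi3 : Integrable F₃ :=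
    (integrableOn_const (by rw [Real.volume_Ioc]; exact ENNReal.ofReal_ne_top)
      (C := D)).integrable_indicator measurableSet_Ioc
  have hi4 : Integrable F₄ := hEi'.integrable_indicator measurableSet_Icc
  have hIF : IntegrableOn F (Ioi 0) := ((hi1.add hi2).add hi3).integrableOn
  have hIabs : Integrable (fun x ↦ F |x|) := by
    have h1 : IntegrableOn (fun x ↦ F |x|) (Ioi 0) :=
      hIF.congr_fun (fun x hx ↦ by rw [abs_of_pos (mem_Ioi.1 hx)]) measurableSet_Ioi
    have h2 : IntegrableOn (fun x ↦ F |x|) (Iic 0) := by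
      rw [← Measure.map_neg_eq_self (volume : Measure ℝ)]
      let m : MeasurableEmbedding fun x : ℝ ↦ -x := (Homeomorph.neg ℝ).measurableEmbedding
      rw [m.integrableOn_map_iff]
      simp_rw [Function.comp_def, abs_neg, neg_preimage, neg_Iic, neg_zero]
      exact Iff.mpr integrableOn_Ici_iff_integrableOn_Ioi h1
    have := h2.union h1
    rwa [Iic_union_Ioi, integrableOn_univ] at this
  -- the integrals of the majorants
  have hI1 : ∫ r in Ioi 0, F₁ r = A * b := by
    rw [hF₁, setIntegral_indicator measurableSet_Ioc, inter_eq_right.2 Ioc_subset_Ioi_self,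
      setIntegral_const, Real.volume_real_Ioc_of_le hb0.le, sub_zero, smul_eq_mul, mul_comm]
  have hI2 : ∫ r in Ioi 0, F₂ r ≤ 3 * C ^ 2 * S * (h * G) := by
    rw [hF₂, setIntegral_indicator measurableSet_Ioc, inter_eq_right.2 Ioc_subset_Ioi_self,
      integral_const_mul]
    refine mul_le_mul_of_nonneg_left ?_ (by positivity)
    rw [← intervalIntegral.integral_of_le hc0]
    have hmono : MonotoneOn (cuspCoord a) (Icc 0 (c + h)) := fun x hx y hy hxy ↦
      cuspCoord_mono (by linarith [hx.1]) hxy (by linarith [hy.2])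
    have h1 := integral_shift_sub_le hc0 hh0.le hmono
    have h2 : cuspCoord a (c + h) ≤ G := cuspCoord_le (by linarith)
    rw [cuspCoord_zero, sub_zero] at h1
    exact h1.trans (mul_le_mul_of_nonneg_left h2 hh0.le)
  have hI3 : ∫ r in Ioi 0, F₃ r = D * δ := by
    rw [hF₃, setIntegral_indicator measurableSet_Ioc,
      inter_eq_right.2 (Ioc_subset_Ioi_self.trans (Ioi_subset_Ioi hc0)),
      setIntegral_const, Real.volume_real_Ioc_of_le (by linarith), smul_eq_mul, hc_def]
    ring
  have hI4 : ∫ x, F₄ x ≤ 3 * w * (2 * h * ω (2 * a)) := by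
    rw [hF₄, integral_indicator measurableSet_Icc, integral_Icc_eq_integral_Ioc,
      ← intervalIntegral.integral_of_le (by linarith : -b ≤ b),
      intervalIntegral.integral_const_mul]
    exact mul_le_mul_of_nonneg_left (integral_remainder_shift_le hR hh0.le hhb hab)
      (by positivity)
  have hIF' : ∫ r in Ioi 0, F r ≤ A * b + 3 * C ^ 2 * S * (h * G) + D * δ := by
    have e : ∫ r in Ioi 0, F r = (∫ r in Ioi 0, F₁ r) + (∫ r in Ioi 0, F₂ r) +
        ∫ r in Ioi 0, F₃ r := by
      simp only [hF_def]
      rw [integral_add (f := fun r ↦ F₁ r + F₂ r) (g := F₃) (hi1.add hi2).integrableOn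
        hi3.integrableOn, integral_add (f := F₁) (g := F₂) hi1.integrableOn hi2.integrableOn]
    rw [e, hI1, hI3]
    linarith [hI2]
  -- assemble
  calc ∫ x, ‖weilInteriorDefect a u η x‖ ^ 2 ≤ ∫ x, (F |x| + F₄ x) := by
        refine integral_mono_of_nonneg (ae_of_all _ fun x ↦ by positivity) (hIabs.add hi4) ?_
        filter_upwards [Measure.ae_ne volume (0 : ℝ)] with x hx using hpt x hx
    _ = 2 * (∫ r in Ioi 0, F r) + ∫ x, F₄ x := by
        rw [integral_add hIabs hi4, integral_comp_abs]
    _ ≤ 2 * (A * b + 3 * C ^ 2 * S * (h * G) + D * δ) + 3 * w * (2 * h * ω (2 * a)) := by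
        linarith [hIF', hI4]
    _ ≤ 6 * a * η ^ 2 * B ^ 2 + 6 * C ^ 2 * S * (h * G) +
          24 * C ^ 2 * cuspPrim a h ^ 2 * δ + 6 * h * w * ω (2 * a) := by
        rw [hA_def, hD_def]
        nlinarith [mul_le_mul_of_nonneg_left hb (by positivity : 0 ≤ 6 * η ^ 2 * B ^ 2)]

end Summit.RiemannHypothesis.RiemannHypothesis.Theorems.PfPersistence

end
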